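import Summits.CriticalPhenomena.Ising3DConformalLimit.Theses.PrimaryAtInfinity
import HarnessLib
import HarnessLib.Audit

/-!
# Birth skeleton (BC3) for crux `FirstMultipoleIdentity` — item stmt-CriticalPhenomena-5352,
# route-CriticalPhenomena-PrimaryAtInfinity (rank 2), sub-problem `Ising3DConformalLimit`

Registered file `Cruxes/FirstMultipoleIdentity/Lines/birth.lean` (planner-skel-stmt-CriticalPhenomena-5352-0, 2026-08-17).

THE CRUX (by name `PrimaryAtInfinity.FirstMultipoleIdentity`, grounded g13-38, route-review c23efa21): for every
pointwise scaling limit `S` of `criticalCorr 3` (`ρ > 0` on `(0,1]`) that is normalised (`S = 0` off `NonCoincident`)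
and has two-point function `c‖a−b‖^(−2Δ)` (`c > 0`), and every `n`, there are far-field coefficients
`A₀ : (ℝ³)ⁿ → ℝ`, `A₁ : (ℝ³)ⁿ → ℝ³` with (E) `‖y‖^(2Δ+1) S_(n+1)(x,y) − ‖y‖A₀(x) − ⟪A₁(x),ŷ⟫ → 0` as `‖y‖ → ∞`
locally uniformly on `NonCoincident 3 n`, and (W) the WEAK first-multipole identity
`∫ ⟪A₁,b⟫ φ = ∫ A₀ [(2Δ−6)(Σᵢ⟪b,xᵢ⟫) φ + Dφ[(‖xᵢ‖²b − 2⟪b,xᵢ⟫xᵢ)ᵢ]]` for all `b` and all smooth `φ` compactly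
supported in `NonCoincident 3 n` ("dipole = 𝒦̃(monopole)").

THE LINE (existence · regularity · pointwise identity · weak passage — the crux's own anatomy: its "why it might
fail" names exactly two risks, the far-field EXPANSION and the IDENTITY, and the identity is physically a pointwise
PDE `A₁ = 𝒦̃A₀` whose weak form is what the route consumes):

* STUB 1 `stub_farFieldExpansion` — (E) holds for some `(A₀, A₁)`, every `n` (first-order OPE convergence at `∞`;
  pins the coefficients on `NonCoincident`). OPEN.
* STUB 2 `stub_monopoleRegular` — every such monopole coefficient `A₀` is `C¹` on `NonCoincident 3 n`. OPEN (regularity;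
  in tree only continuity, and only given continuity of `S_(n+1)`).
* STUB 3 `stub_dipoleEqualsKMonopole` — THE PHYSICS: pointwise `⟪A₁(x),b⟫ = 2Δ(Σᵢ⟪b,xᵢ⟫)A₀(x) − DA₀(x)[(K_b(xᵢ))ᵢ]`
  on `NonCoincident 3 n` for every far-field pair with `A₀ ∈ C¹` (the `‖y‖^(−2Δ)` order of the special-conformal Ward
  identity of `S_(n+1)`; "σ is primary at infinity"). OPEN — false iff the `ℤ³` limit carries a virial current.
* STUB 4 `stub_weakOfStrong` — strong ⇒ weak by integration by parts on `(ℝ³)ⁿ` with `div_x K_b = −6⟪b,x⟫` (`d = 3`),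
  for `A₀ ∈ C¹(NonCoincident)`, `φ ∈ C_c^∞(NonCoincident)`. PROVABLE NOW (pure calculus, size M).

COMPOSITION (`FirstMultipoleIdentity_of`, kernel-checked, sorry-free, axioms ⊆ {propext, Classical.choice, Quot.sound}):
fix `(ρ,S,c,Δ)` and `n`; STUB 1 gives `(A₀,A₁)` with (E); STUB 2 gives `A₀ ∈ C¹`; STUB 3 the pointwise identity; STUB 4
turns it into (W); `⟨A₀, A₁, (E), (W)⟩` is the crux at `n`. The hypotheses of `FirstMultipoleIdentity_of` are the four stub
STATEMENTS as named propositions `Stmt.stub_*` (verbatim copies, so the skeleton audit sees registered obligations by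
name), and `FirstMultipoleIdentity_of_stubs : FirstMultipoleIdentity := FirstMultipoleIdentity_of stub₁ stub₂ stub₃ stub₄`
checks in the kernel that the registered stubs have exactly those types.

NOT SHREDDED / NOT COSTUME. No stub is cheaply the crux or the summit (BC3 probes, planner folder
`bc/probe_stub_<name>.lean`, `set_option maxHeartbeats 400000`, importing only the route file: for each stub statement
`T`, `T → FirstMultipoleIdentity` and `T → Ising3DConformalLimit`, one `example` per tactic of the battery
`exact? | simpa | simpa [C] | (unfold C; simpa) | aesop` — 4 stubs × 2 targets × 5 tactics = 40/40 FAIL, no timeouts: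
`exact?` "could not close the goal", the three `simpa` forms "assumption failed", `aesop` "failed to prove the goal after
exhaustive search"): STUB 1 lacks the identity, STUBS 2–4 lack
existence (and 4 is true for every family, so it cannot carry the crux), and the summit is existential with clause (iii)
`HasNontrivialU4` on top. STUB 3 is not the crux reworded: it is universal over coefficient pairs, pointwise (a PDE in
`fderiv A₀`), and needs STUBS 1, 2, 4 to reach the crux; conversely the crux gives STUB 3 only through uniqueness of
asymptotic coefficients + the fundamental lemma of the calculus of variations + `C¹` regularity.

DISPROOF USED. None exists: `ledger crux ls stmt-CriticalPhenomena-5352` showed no workfiles (no `Disproof.lean`, no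
`_false_without_` theorem, no `Theorems/FirstMultipoleIdentity/Negative/*`) at registration; `ledger negatives --problem
CriticalPhenomena` lists 11 refuted statements, none in `Ising3DConformalLimit`, none about far-field expansions or Ward
identities. Honoured lessons: every stub about the Ising limit keeps the crux's normalisation `S = 0` off `NonCoincident`
(IsingEuclidUpgradeRefutations / `not_euclideanScaleUpgrade`); the barrier `ScaleCovarianceNotMoebius` witness fails (E).

Sources: route header (PrimaryAtInfinity: WHY THIS LINE, RANKED CRUXES #2, TWO-LAYER PLAN); FrancescoMathieuSenechal1997
§4.1–4.3; DelamotteTissierWschebor2016 (arXiv:1501.01776) §5–6; PolandRychkovVichi2019 §II; HormanderALPDO1 §1.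
-/

noncomputable section

namespace Summit.CriticalPhenomena.Ising3DConformalLimit.Cruxes.FirstMultipoleIdentity.Birth

open scoped BigOperators Topology
open Filter Set MeasureTheory Literature.Probability.LatticeModels
open Summit.CriticalPhenomena.Ising3DConformalLimit.Theses.PrimaryAtInfinity (FirstMultipoleIdentity)

/-! ## The four registered stubs (the only `sorry`s of this file) -/

/-- **STUB 1 — far-field (multipole-at-infinity) expansion to FIRST order exists** (OPE convergence at `∞`;
the crux's "why it might fail" names it: "presupposes an `o(‖y‖^(−2Δ−1))` far-field expansion, unproved for odd
`n+1 ≥ 4`"). For every normalised pointwise scaling limit `S` of `criticalCorr 3` with two-point law `c‖a−b‖^(−2Δ)`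
and every `n` there are coefficients `A₀` (monopole) and `A₁` (dipole) with
`‖y‖^(2Δ+1) S_(n+1)(x,y) − ‖y‖ A₀(x) − ⟪A₁(x), ŷ⟫ → 0` as `‖y‖ → ∞`, locally uniformly in `x ∈ NonCoincident 3 n`.
This is the first conjunct of the crux and PINS `(A₀, A₁)` on `NonCoincident 3 n` (uniqueness of asymptotic
coefficients), so stubs 2–3 speak about THE coefficients. Trivial at even `n` (`S_(n+1) ≡ 0`,
`criticalCorr_eq_zero_of_odd`); explicit at `n = 1` (`A₀ = c`, `A₁ = 2Δc·x`). Why it might fail: without conformal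
two-point orthogonality a `ℤ₂`-odd operator `O'` with `Δ < Δ' < Δ + 1` and `⟨σ O'⟩ ≠ 0` would insert a
non-integer order `‖y‖^(−Δ−Δ')` between monopole and dipole (bootstrap/MC spectra show no such operator:
`Δ_{σ'} ≈ 5.29`, PolandRychkovVichi2019 Table II — not rigorous). OPEN.
[cite: FrancescoMathieuSenechal1997, §4.2.1 (4.31)–(4.32)] [cite: PolandRychkovVichi2019, §II and Table II] -/
theorem stub_farFieldExpansion :
    ∀ (ρ : ℝ → ℝ) (S : CorrFamily 3) (c Δ : ℝ), (∀ δ ∈ Set.Ioc (0:ℝ) 1, 0 < ρ δ) →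
      HasPointwiseScalingLimit (criticalCorr 3) ρ S → (∀ n z, z ∉ NonCoincident 3 n → S n z = 0) →
      0 < c → (∀ a b : EuclideanSpace ℝ (Fin 3), a ≠ b → S 2 ![a, b] = c * ‖a - b‖ ^ (-(2 * Δ))) →
      ∀ n : ℕ, ∃ (A₀ : (Fin n → EuclideanSpace ℝ (Fin 3)) → ℝ)
        (A₁ : (Fin n → EuclideanSpace ℝ (Fin 3)) → EuclideanSpace ℝ (Fin 3)),
        TendstoLocallyUniformlyOn
          (fun (y : EuclideanSpace ℝ (Fin 3)) (x : (Fin n → EuclideanSpace ℝ (Fin 3))) =>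
            ‖y‖ ^ (2 * Δ + 1) * S (n + 1) (Fin.snoc x y) - ‖y‖ * A₀ x - inner ℝ (A₁ x) (‖y‖⁻¹ • y))
          0 (cocompact (EuclideanSpace ℝ (Fin 3))) (NonCoincident 3 n) := by
  sorry

/-- **STUB 2 — the monopole coefficient is `C¹` off the diagonals.** For every normalised limit with the two-point law
and every pair `(A₀, A₁)` of first-order far-field coefficients of `S_(n+1)` (stub 1's clause, which determines them
on `NonCoincident 3 n`), `A₀` is continuously differentiable on the open set `NonCoincident 3 n`
(`isOpen_nonCoincident`). Physically `A₀(x) = ⟨σ̃(∞) σ(x₁)⋯σ(xₙ)⟩` is real-analytic off coincidences; in tree only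
CONTINUITY of `A₀` is known, and only given continuity of `S_(n+1)` (`continuousOn_monopole`,
Theorems/PrimaryAtInfinityMultipoleToWardRegularity). Needed to state stub 3 pointwise (`fderiv`) and to integrate
by parts in stub 4. Why it might fail: an arbitrary pointwise scaling limit need not be `C¹` (no regularity theory
for Ising₃ `n`-point limits beyond Messager–Miracle-Solé monotonicity). OPEN (regularity).
[cite: FrancescoMathieuSenechal1997, §4.3.1] -/
theorem stub_monopoleRegular :
    ∀ (ρ : ℝ → ℝ) (S : CorrFamily 3) (c Δ : ℝ), (∀ δ ∈ Set.Ioc (0:ℝ) 1, 0 < ρ δ) →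
      HasPointwiseScalingLimit (criticalCorr 3) ρ S → (∀ n z, z ∉ NonCoincident 3 n → S n z = 0) →
      0 < c → (∀ a b : EuclideanSpace ℝ (Fin 3), a ≠ b → S 2 ![a, b] = c * ‖a - b‖ ^ (-(2 * Δ))) →
      ∀ (n : ℕ) (A₀ : (Fin n → EuclideanSpace ℝ (Fin 3)) → ℝ)
        (A₁ : (Fin n → EuclideanSpace ℝ (Fin 3)) → EuclideanSpace ℝ (Fin 3)),
        TendstoLocallyUniformlyOn
          (fun (y : EuclideanSpace ℝ (Fin 3)) (x : (Fin n → EuclideanSpace ℝ (Fin 3))) =>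
            ‖y‖ ^ (2 * Δ + 1) * S (n + 1) (Fin.snoc x y) - ‖y‖ * A₀ x - inner ℝ (A₁ x) (‖y‖⁻¹ • y))
          0 (cocompact (EuclideanSpace ℝ (Fin 3))) (NonCoincident 3 n) →
        ContDiffOn ℝ 1 A₀ (NonCoincident 3 n) := by
  sorry

/-- **STUB 3 — DIPOLE = 𝒦̃(MONOPOLE), strong (pointwise) form — the physics of the crux.** For every normalised limit
with the two-point law, every `n`, and every pair of far-field coefficients `(A₀, A₁)` of `S_(n+1)` with `A₀ ∈ C¹`
on `NonCoincident 3 n`: for all `b ∈ ℝ³` and `x ∈ NonCoincident 3 n`,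
`⟪A₁(x), b⟫ = 2Δ (Σᵢ ⟪b, xᵢ⟫) A₀(x) − DA₀(x)[(‖xᵢ‖² b − 2⟪b,xᵢ⟫ xᵢ)ᵢ]`, i.e. `A₁·b = [2Δ Σᵢ b·xᵢ − Σᵢ K_b(xᵢ)·∇ᵢ] A₀`
with `K_b(x) = ‖x‖² b − 2(b·x) x`: the `‖y‖^(−2Δ)` coefficient of the special-conformal Ward identity of `S_(n+1)` as
the last spin recedes ("σ is primary at infinity": the first descendant at `∞` is generated by `K = ιPι`). Checked by
hand on `n = 1` (`A₀ = c`, `A₁ = 2Δc x`) and on the generalised free field (`(K_b(u) − K_b(v))·(u − v) =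
−‖u−v‖²(b·u + b·v)`). Why it might fail: false iff the `ℤ³` limit is scale- but not Möbius-covariant — a conserved
dimension-2 virial current adds to `A₁` a translation-invariant, rotation-covariant defect of degree `1 − (n−1)Δ`
invisible to translations/rotations/dilations (excluded only by the non-rigorous RG argument of
Delamotte–Tissier–Wschebor 2016 §5–6 and by MC `Δ_V > 5`); the tree barrier `ScaleCovarianceNotMoebius` witness
(`Δ = 1/2`, `S₄ = Σ_pairs ‖·‖⁻²`) fails stub 1's expansion (`S₄ ↛ 0`), so it does not refute this. OPEN (the crux proper).
[cite: FrancescoMathieuSenechal1997, §4.1 (4.14)–(4.19) and §4.2.1 (4.31)–(4.32)] [cite: DelamotteTissierWschebor2016, §5–6] -/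
theorem stub_dipoleEqualsKMonopole :
    ∀ (ρ : ℝ → ℝ) (S : CorrFamily 3) (c Δ : ℝ), (∀ δ ∈ Set.Ioc (0:ℝ) 1, 0 < ρ δ) →
      HasPointwiseScalingLimit (criticalCorr 3) ρ S → (∀ n z, z ∉ NonCoincident 3 n → S n z = 0) →
      0 < c → (∀ a b : EuclideanSpace ℝ (Fin 3), a ≠ b → S 2 ![a, b] = c * ‖a - b‖ ^ (-(2 * Δ))) →
      ∀ (n : ℕ) (A₀ : (Fin n → EuclideanSpace ℝ (Fin 3)) → ℝ)
        (A₁ : (Fin n → EuclideanSpace ℝ (Fin 3)) → EuclideanSpace ℝ (Fin 3)),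
        TendstoLocallyUniformlyOn
          (fun (y : EuclideanSpace ℝ (Fin 3)) (x : (Fin n → EuclideanSpace ℝ (Fin 3))) =>
            ‖y‖ ^ (2 * Δ + 1) * S (n + 1) (Fin.snoc x y) - ‖y‖ * A₀ x - inner ℝ (A₁ x) (‖y‖⁻¹ • y))
          0 (cocompact (EuclideanSpace ℝ (Fin 3))) (NonCoincident 3 n) →
        ContDiffOn ℝ 1 A₀ (NonCoincident 3 n) →
        ∀ b : EuclideanSpace ℝ (Fin 3), ∀ x ∈ NonCoincident 3 n,
          inner ℝ (A₁ x) b =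
            2 * Δ * (∑ i, inner ℝ b (x i)) * A₀ x
              - fderiv ℝ A₀ x (fun i => ‖x i‖ ^ 2 • b - (2 * inner ℝ b (x i)) • x i) := by
  sorry

/-- **STUB 4 — strong ⇒ weak first-multipole identity (integration by parts on configuration space; pure calculus,
provable now, size M).** For any `Δ`, `n`, any `A₀ ∈ C¹(NonCoincident 3 n)` and any `A₁` satisfying the pointwise
identity of stub 3 on `NonCoincident 3 n`, and every smooth `φ` compactly supported inside `NonCoincident 3 n`:
`∫ ⟪A₁,b⟫ φ = ∫ A₀ [(2Δ − 6)(Σᵢ ⟪b,xᵢ⟫) φ + Dφ[(‖xᵢ‖² b − 2⟪b,xᵢ⟫ xᵢ)ᵢ]]` — the crux's weak form. Proof sketch: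
`−∫ φ DA₀[V] = ∫ A₀ (Dφ[V] + φ div V)` for the compactly supported `C¹` field `φ A₀ V`, `V = (K_b(xᵢ))ᵢ`, and
`div V = Σᵢ div K_b(xᵢ) = −6 Σᵢ ⟪b,xᵢ⟫` in `d = 3` (`∂_μ K^ν = 2x_μ b^ν − 2b_μ x^ν − 2⟪b,x⟫δ_μ^ν`); no measurability of
`A₁` is needed (on `tsupport φ ⊆ NonCoincident` the integrand `⟪A₁,b⟫φ` equals the continuous `(2Δ Σ⟪b,xᵢ⟫ A₀ − DA₀[V]) φ`,
and both vanish off `tsupport φ`). Why it might fail: it cannot mathematically; the Lean cost is the divergence theorem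
for compactly supported `C¹` fields on `(Fin n → ℝ³)` (Mathlib: `integral_mul_fderiv_eq_neg_fderiv_mul_of_integrable`-type
lemmas coordinatewise). [cite: HormanderALPDO1, §1 (test functions, integration by parts)] -/
theorem stub_weakOfStrong :
    ∀ (Δ : ℝ) (n : ℕ) (A₀ : (Fin n → EuclideanSpace ℝ (Fin 3)) → ℝ)
      (A₁ : (Fin n → EuclideanSpace ℝ (Fin 3)) → EuclideanSpace ℝ (Fin 3)),
      ContDiffOn ℝ 1 A₀ (NonCoincident 3 n) →
      (∀ b : EuclideanSpace ℝ (Fin 3), ∀ x ∈ NonCoincident 3 n,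
          inner ℝ (A₁ x) b =
            2 * Δ * (∑ i, inner ℝ b (x i)) * A₀ x
              - fderiv ℝ A₀ x (fun i => ‖x i‖ ^ 2 • b - (2 * inner ℝ b (x i)) • x i)) →
      ∀ (b : EuclideanSpace ℝ (Fin 3)) (φ : (Fin n → EuclideanSpace ℝ (Fin 3)) → ℝ),
        ContDiff ℝ ((⊤ : ℕ∞) : WithTop ℕ∞) φ → HasCompactSupport φ → tsupport φ ⊆ NonCoincident 3 n →
        ∫ x, inner ℝ (A₁ x) b * φ x =
          ∫ x, A₀ x * ((2 * Δ - 6) * (∑ i, inner ℝ b (x i)) * φ x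
            + fderiv ℝ φ x (fun i => ‖x i‖ ^ 2 • b - (2 * inner ℝ b (x i)) • x i)) := by
  sorry

/-! ## The stub statements by name -/

/-- The STATEMENT of `stub_farFieldExpansion` as a named proposition (verbatim copy of its signature; used as the hypothesis type of
`FirstMultipoleIdentity_of`, so that the skeleton audit sees a registered obligation by name). [folklore] -/
def Stmt.stub_farFieldExpansion : Prop :=
    ∀ (ρ : ℝ → ℝ) (S : CorrFamily 3) (c Δ : ℝ), (∀ δ ∈ Set.Ioc (0:ℝ) 1, 0 < ρ δ) →
      HasPointwiseScalingLimit (criticalCorr 3) ρ S → (∀ n z, z ∉ NonCoincident 3 n → S n z = 0) →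
      0 < c → (∀ a b : EuclideanSpace ℝ (Fin 3), a ≠ b → S 2 ![a, b] = c * ‖a - b‖ ^ (-(2 * Δ))) →
      ∀ n : ℕ, ∃ (A₀ : (Fin n → EuclideanSpace ℝ (Fin 3)) → ℝ)
        (A₁ : (Fin n → EuclideanSpace ℝ (Fin 3)) → EuclideanSpace ℝ (Fin 3)),
        TendstoLocallyUniformlyOn
          (fun (y : EuclideanSpace ℝ (Fin 3)) (x : (Fin n → EuclideanSpace ℝ (Fin 3))) =>
            ‖y‖ ^ (2 * Δ + 1) * S (n + 1) (Fin.snoc x y) - ‖y‖ * A₀ x - inner ℝ (A₁ x) (‖y‖⁻¹ • y))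
          0 (cocompact (EuclideanSpace ℝ (Fin 3))) (NonCoincident 3 n)

/-- The STATEMENT of `stub_monopoleRegular` as a named proposition (verbatim copy of its signature; used as the hypothesis type of
`FirstMultipoleIdentity_of`, so that the skeleton audit sees a registered obligation by name). [folklore] -/
def Stmt.stub_monopoleRegular : Prop :=
    ∀ (ρ : ℝ → ℝ) (S : CorrFamily 3) (c Δ : ℝ), (∀ δ ∈ Set.Ioc (0:ℝ) 1, 0 < ρ δ) →
      HasPointwiseScalingLimit (criticalCorr 3) ρ S → (∀ n z, z ∉ NonCoincident 3 n → S n z = 0) →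
      0 < c → (∀ a b : EuclideanSpace ℝ (Fin 3), a ≠ b → S 2 ![a, b] = c * ‖a - b‖ ^ (-(2 * Δ))) →
      ∀ (n : ℕ) (A₀ : (Fin n → EuclideanSpace ℝ (Fin 3)) → ℝ)
        (A₁ : (Fin n → EuclideanSpace ℝ (Fin 3)) → EuclideanSpace ℝ (Fin 3)),
        TendstoLocallyUniformlyOn
          (fun (y : EuclideanSpace ℝ (Fin 3)) (x : (Fin n → EuclideanSpace ℝ (Fin 3))) =>
            ‖y‖ ^ (2 * Δ + 1) * S (n + 1) (Fin.snoc x y) - ‖y‖ * A₀ x - inner ℝ (A₁ x) (‖y‖⁻¹ • y))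
          0 (cocompact (EuclideanSpace ℝ (Fin 3))) (NonCoincident 3 n) →
        ContDiffOn ℝ 1 A₀ (NonCoincident 3 n)

/-- The STATEMENT of `stub_dipoleEqualsKMonopole` as a named proposition (verbatim copy of its signature; used as the hypothesis type of
`FirstMultipoleIdentity_of`, so that the skeleton audit sees a registered obligation by name). [folklore] -/
def Stmt.stub_dipoleEqualsKMonopole : Prop :=
    ∀ (ρ : ℝ → ℝ) (S : CorrFamily 3) (c Δ : ℝ), (∀ δ ∈ Set.Ioc (0:ℝ) 1, 0 < ρ δ) →
      HasPointwiseScalingLimit (criticalCorr 3) ρ S → (∀ n z, z ∉ NonCoincident 3 n → S n z = 0) →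
      0 < c → (∀ a b : EuclideanSpace ℝ (Fin 3), a ≠ b → S 2 ![a, b] = c * ‖a - b‖ ^ (-(2 * Δ))) →
      ∀ (n : ℕ) (A₀ : (Fin n → EuclideanSpace ℝ (Fin 3)) → ℝ)
        (A₁ : (Fin n → EuclideanSpace ℝ (Fin 3)) → EuclideanSpace ℝ (Fin 3)),
        TendstoLocallyUniformlyOn
          (fun (y : EuclideanSpace ℝ (Fin 3)) (x : (Fin n → EuclideanSpace ℝ (Fin 3))) =>
            ‖y‖ ^ (2 * Δ + 1) * S (n + 1) (Fin.snoc x y) - ‖y‖ * A₀ x - inner ℝ (A₁ x) (‖y‖⁻¹ • y))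
          0 (cocompact (EuclideanSpace ℝ (Fin 3))) (NonCoincident 3 n) →
        ContDiffOn ℝ 1 A₀ (NonCoincident 3 n) →
        ∀ b : EuclideanSpace ℝ (Fin 3), ∀ x ∈ NonCoincident 3 n,
          inner ℝ (A₁ x) b =
            2 * Δ * (∑ i, inner ℝ b (x i)) * A₀ x
              - fderiv ℝ A₀ x (fun i => ‖x i‖ ^ 2 • b - (2 * inner ℝ b (x i)) • x i)

/-- The STATEMENT of `stub_weakOfStrong` as a named proposition (verbatim copy of its signature; used as the hypothesis type of
`FirstMultipoleIdentity_of`, so that the skeleton audit sees a registered obligation by name). [folklore] -/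
def Stmt.stub_weakOfStrong : Prop :=
    ∀ (Δ : ℝ) (n : ℕ) (A₀ : (Fin n → EuclideanSpace ℝ (Fin 3)) → ℝ)
      (A₁ : (Fin n → EuclideanSpace ℝ (Fin 3)) → EuclideanSpace ℝ (Fin 3)),
      ContDiffOn ℝ 1 A₀ (NonCoincident 3 n) →
      (∀ b : EuclideanSpace ℝ (Fin 3), ∀ x ∈ NonCoincident 3 n,
          inner ℝ (A₁ x) b =
            2 * Δ * (∑ i, inner ℝ b (x i)) * A₀ x
              - fderiv ℝ A₀ x (fun i => ‖x i‖ ^ 2 • b - (2 * inner ℝ b (x i)) • x i)) →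
      ∀ (b : EuclideanSpace ℝ (Fin 3)) (φ : (Fin n → EuclideanSpace ℝ (Fin 3)) → ℝ),
        ContDiff ℝ ((⊤ : ℕ∞) : WithTop ℕ∞) φ → HasCompactSupport φ → tsupport φ ⊆ NonCoincident 3 n →
        ∫ x, inner ℝ (A₁ x) b * φ x =
          ∫ x, A₀ x * ((2 * Δ - 6) * (∑ i, inner ℝ b (x i)) * φ x
            + fderiv ℝ φ x (fun i => ‖x i‖ ^ 2 • b - (2 * inner ℝ b (x i)) • x i))

/-! ## Composition (sorry-free) -/

/-- **THE SKELETON THEOREM.** STUB 1 → STUB 2 → STUB 3 → STUB 4 → `PrimaryAtInfinity.FirstMultipoleIdentity` (the crux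
BY NAME): existence of the far-field pair, `C¹` regularity of the monopole, the pointwise identity, and its weak form by
integration by parts. Pure logic; no `sorry`; its hypotheses are exactly the four stub statements (`Stmt.stub_*`).
[cite: FrancescoMathieuSenechal1997, §4.2.1 (4.31)–(4.32)] -/
theorem FirstMultipoleIdentity_of (h₁ : Stmt.stub_farFieldExpansion) (h₂ : Stmt.stub_monopoleRegular)
    (h₃ : Stmt.stub_dipoleEqualsKMonopole) (h₄ : Stmt.stub_weakOfStrong) : FirstMultipoleIdentity := by
  intro ρ S c Δ hρ hlim hnorm hc h2pt n
  obtain ⟨A₀, A₁, hexp⟩ := h₁ ρ S c Δ hρ hlim hnorm hc h2pt n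
  have hreg : ContDiffOn ℝ 1 A₀ (NonCoincident 3 n) := h₂ ρ S c Δ hρ hlim hnorm hc h2pt n A₀ A₁ hexp
  have hstrong := h₃ ρ S c Δ hρ hlim hnorm hc h2pt n A₀ A₁ hexp hreg
  exact ⟨A₀, A₁, hexp, h₄ Δ n A₀ A₁ hreg hstrong⟩

/-- The crux from the four registered stubs (kernel check that the stubs have exactly the hypothesis types of
`FirstMultipoleIdentity_of`; its only `sorry`s are the stubs'). [folklore] -/
theorem FirstMultipoleIdentity_of_stubs : FirstMultipoleIdentity :=
  FirstMultipoleIdentity_of stub_farFieldExpansion stub_monopoleRegular stub_dipoleEqualsKMonopole stub_weakOfStrong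

end Summit.CriticalPhenomena.Ising3DConformalLimit.Cruxes.FirstMultipoleIdentity.Birth

end
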